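import Literature.MathematicalPhysics.QuantumFieldTheory.Balaban1983to89.B3Eq121LabelledDyson
import Literature.MathematicalPhysics.QuantumFieldTheory.Balaban1983to89.B3Eq119ConnectedGraphs

/-!
# `Balaban1983to89.B3Eq121DysonFromEq119` — T. Bałaban, *(Higgs)₂,₃ quantum fields in a finite volume. III.
# Renormalization*, Commun. Math. Phys. **88** (1983) 411–445 [Balaban1983Higgs3], (1.19)–(1.21) p. 416 — (1.21) FROM (1.19):
# AT `e = 0` THE VERTEX COEFFICIENTS `(d/dt)ⁿG^ε_t|₀` OF THE TWO-POINT FUNCTION (BRICK 5: SUMS OVER CONNECTED FEYNMAN GRAPHS)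
# ARE `n!·coeffₙ` OF THE TWO-POINT SERIES `G(t)` OF THE LABELLED MACHINE, WHICH SATISFIES THE DYSON EQUATION `Eq121` WITH THE
# ONE-PARTICLE-IRREDUCIBLE INSERTION AND EQUALS THE PRINTED SERIES `Σₙ C₀[XC₀]ⁿ` (BRICK 9, FILE 4 of «amputation / 1PI / Dyson
# resummation FROM (1.19)»: the instance on BRICK 5's `(Higgs)₂,₃` carrier)

statement-level skeleton of published theorems with citation tags; proofs where landed; nothing here is a claim about
the Yang–Mills mass gap

PDF held: `paper:balaban1983-higgs-2-3-quantum-fields-finite-volume` (journal page = PDF page + 410); p. 416 (PDF 6) L12–21,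
p. 414 (PDF 4) L38–43 and p. 417 (PDF 7) L24–38 read in the text layer this session.

CITATION HEADER (lean-in-tree rule).  Part of the lit-balaban TYPED SKELETON (HOME `run/shared/lean/pub/lit-balaban/`),
Phase 2, proof seat p33 (gen 73, unit `lit-balaban-p33`; TAKING HOME/STATUS.md 2026-08-23T17:00:23Z, owner r15 g16 «WELCOME —
PRIORITY YOURS» 17:02:01Z); row **B3.Eq1.19-1.22** of `HOME/lit-balaban-r15/ROWS-B3.md` (fold owner r15, referee ref-4; head
`proved`, HEAD WORDS Q25/Q28/Q28′/Q28″ — this file is an OPTIONAL located member, zero head weight; it bears on the clause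
word «Dyson from (1.19) not» of Q28″).  WHAT IS REPRODUCED: the last step of «amputation / 1PI / Dyson resummation FROM
(1.19)»: BRICK 5 B (`B3Eq119ConnectedGraphs.iteratedDerivWithin_twoPointFamily_eq_sum_connected`: at `e = 0` the `n`-th vertex
coefficient of (1.19) is `Σ_{colourings} Π coef · Σ_{CONNECTED LegDiagram graphs} Π pairW`) is identified with FILE 3's
two-point series: `(d/dt)ⁿG^ε_t|₀(x,a;x′,b) = δ_{n0}C₀ + (C₀·𝔸ₙ·C₀)((x,a),(x′,b)) = n!·coeffₙ G(t)` for the vertex data (1.20)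
(`higgsVD`: quartic and mass colours at all points/indices, leg positions `legPos`, coefficients `−λε^d`, `−½δm²ε^d`) and the
free propagator matrix `C₀ = prop0`; whence, by FILE 3 verbatim (`C₀` symmetric), r15's `B3Sect1TwoPoint.Eq121 G(t) C₀ 𝕂(t)`,
p32's `𝕂(t) = sigmaSeries gAmp gDeg` (ι := the labelled coloured amputated 1PI two-point graphs), `G(t) = greenSeries C₀ gAmp
gDeg = Σ'ₙ dysonTerm C₀ 𝕂(t) n` — the packaged headline **`dyson_from_eq119`**.  USED BY NAME, nothing re-declared: BRICK 5
(`Colour`, `cdeg`, `legPos`, `clv`, `ccoef`, `cK`, `prop0`, `prop0_symm`, `precMat`, `pairW_legs`, `twoPointFamily_zero`,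
`iteratedDerivWithin_twoPointFamily_eq_sum_connected`), the engine `B3GaussianPerturbationGraphs` (`Leg`, `legVec`, `pairW`,
`pairW_of_card_ne_two`, `present`), p13/p18's `LegDiagram` (`diags`, `IsDiag`, `IsConn`, `Sep`, `legs`, `mem_diags`) and
`IsSetPartition` API (`blockOf`, `erase`, `insert`), FILE 1 (`legsOf`, `IsPM`, `pmatchings`, `IsAmp`, `Conn`, `ampSet`, `ampSum`,
`card_pair_inter_eq_one_iff`), FILE 2 (`exists_cross_of_mem_of_notMem`, `ampSum_congr`, `mul_posMat_apply`, `sum_posVec_mul`,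
`ampMat`, `ampMat_congr`, `ampMat_map`, `pw`, `pw_pair`, `pw_of_card_ne_two`, `pw_map`, `VertexData` + `act`/`lposOf`/`col`/
`coefOf`/`mem_col`/`ampMatZ`/`AMat`), FILE 3 (`ANat`, `ANat_zero`, `gSer`, `kSer`, `coeff_gSer`, `eq121_gSer`, `kSer_eq_sigmaSeries`,
`gSer_eq_greenSeries`, `gSer_eq_tsum_dysonTerm`), r15's `Eq121`/`dysonTerm`, p32's `sigmaSeries`/`greenSeries`, BRICK 4's
`twoPointFamily`.

THE PRINT (verbatim, p. 416): «The function G^ε has a perturbative expansion of the following structure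
G^ε = Σ_{n=0}^∞ C^ε_0[(−δm² + Σ^ε + ∂^{ε*}Σ^ε_1 + Σ^{ε*}_1∂^ε + ∂^{ε*}Σ^ε_2∂^ε)C^ε_0]ⁿ, (1.21) where C^ε_0 = (−Δ^ε_0 + m²)^{−1} and
Σ^ε, Σ^ε_1, Σ^ε_2 are given by amputated, one-particle-irreducible graphs of the expansion of G^ε. Here we have a graphical
description of the same type as in (1.17) … (of course internal indices and vector indices are understood here).»

THE ARGUMENT (ours).  §1 ATTACHING THE EXTERNAL LEGS (generic): an observable cluster `j₀` with exactly two legs `X ≠ X′`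
(`TwoLegObs`); `attach (a₁, e₁, μ) := {{X,a₁},{X′,e₁}} ∪ μ` maps FILE 1's index set `idx` (entry leg, exit leg, connected
amputated pairing of the vertex clusters `univ ∖ {j₀}`, all legs active) BIJECTIVELY onto LegDiagram's connected perfect
pairings of all the legs (`attach_injOn`, `attach_surjOn`: in a connected pairing with ≥ 1 vertex the partner of `X` is a vertex
leg — else `{j₀}` separates — and so is the partner of `X′`; `isPM_attach`); CONNECTED ⇔ CONNECTED (`isConn_attach`: a separating
`Q ∌ j₀` is empty since FILE 1's `Conn` gives an internal line leaving its vertex set, and `Sep` is complement-symmetric;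
`conn_of_isConn_attach`: a vertex set `S ∌ own a₁` is left by an internal line — by PARITY (FILE 2
`exists_cross_of_mem_of_notMem`, even degrees) if `own e₁ ∈ S`, else because `S` would separate); diagrams with `none ∉ V` have no
observable legs and only pairings weigh (`w = 0` off pairs), so **`sum_conn_diags_eq`**:
`Σ_{g conn} Π_{B∈g} w B = Σ_{a₁} Σ_{e₁≠a₁} w{X,a₁}·w{X′,e₁}·𝒜_U(a₁,e₁)`.  §2 `mul_ampMat_mul_apply`: `(Y·𝒜_U·Z)(p,q) =
Σ_{a₁,e₁} Y(p,pos a₁)·𝒜_U(a₁,e₁)·Z(pos e₁,q)`.  §3 the vertex data `higgsVD` and `C0 = prop0` (symmetric, `C0_isSymm`).  §4 ONE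
COLOURING `z` (observable colour on the cluster `none`, `n ≥ 1` vertices): on the carrier `Leg cdeg z` the observable legs are
`legX = ⟨none,0⟩`, `legX′ = ⟨none,1⟩` at positions `(x,a)`, `(x′,b)` (`twoLegObs`, `posL_legX`), every cluster has `cdeg` legs
(`card_fiber_leg`, even), BRICK 5's `pairW` is FILE 2's `pw C₀ posL` (`pw_eq_pairW`, via `pairW_legs`), so §1–§2 give
**`sum_conn_eq_mul_ampMat_mul`**: `Σ_{g conn} Π pairW = (C₀·𝒜·C₀)((x,a),(x′,b))`.  §5 TRANSPORT (`ampMat_leg_eq_ampMatZ`): both the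
legs `Leg cdeg z` (`embLeg`: `(j,i) ↦ (j, castLE i)`) and FILE 2's universal legs `Fin n × Fin 4` (`embUniv`) embed into
`Option (Fin n) × Fin 4` compatibly with owners, positions and pair weights (FILE 2 `ampMat_map` twice, `pw_map`), with the same
active legs over the vertex clusters (`ampMat_congr`), so `𝒜 = ampMatZ higgsVD C₀ (z ∘ some) (Fin n)`.  §6 COLOURINGS: BRICK 5's
colourings `z ∈ Π_j cK j` of the `n + 1` clusters are FILE 2's colourings `z ∘ some ∈ col univ` of the `n` vertices, with
`Π_j ccoef = coefOf` (`sum_piFinset_cK_eq`, `ccoef_some`); summing, `C₀·(Σ_z coefOf·𝒜_z)·C₀ = C₀·𝔸ₙ·C₀`, which gives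
**`iteratedDerivWithin_twoPointFamily_eq_ANat`** (order `0`: `twoPointFamily_zero` and `𝔸₀ = 0`), then FILE 3's `coeff_gSer` gives
**`iteratedDerivWithin_twoPointFamily_eq_coeff_gSer`**, and FILE 3's `eq121_gSer`/`kSer_eq_sigmaSeries`/`gSer_eq_greenSeries`/
`gSer_eq_tsum_dysonTerm` (with `C0_isSymm`) give **`dyson_from_eq119`**.

WHAT IS PROVED (0 `sorry`, no `Prop` fact; `#print axioms dyson_from_eq119` = `propext`, `Classical.choice`, `Quot.sound`).
* §1 `TwoLegObs`, `attach`, `idx`, `sep_empty_iff`, `sep_compl`, `legs_allV`, `some_mem_map_iff`, `mem_legsOf_univ`, `mem_idx`,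
  `exists_block_eq_pair`, `TwoLegObs.{mem_legs_iff, X_notMem, X'_notMem, isPM_attach, isConn_attach, conn_of_isConn_attach,
  X_notMem_of_mem, X'_notMem_of_mem, pairX_notMem, pairX'_notMem, prod_attach, erase_erase_attach, attach_injOn, attach_surjOn,`
  **`sum_conn_diags_eq`**`}`.
* §2 **`mul_ampMat_mul_apply`**.  §3 `cdeg_le_four`, `cdeg_even`, `vcoef`, `ccoef_some`, **`higgsVD`**, **`C0`**, `C0_isSymm`.
* §4 `legX`, `legX'`, `twoLegObs`, `card_fiber_leg`, `posL`, `posL_legX`, `posL_legX'`, `pw_eq_pairW`, **`sum_conn_eq_mul_ampMat_mul`**.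
* §5 `posO`, `embLeg`, `embUniv`, `map_some_univ`, **`ampMat_leg_eq_ampMatZ`**.
* §6 `vdata`, `cmat`, `sum_piFinset_cK_eq`, **`iteratedDerivWithin_twoPointFamily_eq_ANat`**,
  **`iteratedDerivWithin_twoPointFamily_eq_coeff_gSer`**, **`dyson_from_eq119`**.
HONEST SCOPE.  (i) `e = 0`, `m² > 0`, `μ₀² > 0`, `λ > 0`, level `k = 0` — exactly BRICK 5 B's hypotheses; the charged case
(`e > 0`, BRICK 5′ `B3Eq119ChargedGraphs` with scalar and vector lines) is not instantiated here (FILES 1–3 are carrier-generic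
and would apply to its `LegDiagram` sums with a two-block propagator matrix; not done).  (ii) The expansion variable is BRICK 4's
vertex-counting `t` at fixed `(λ, δm²)`; `G(t)` is a FORMAL power series with matrix coefficients (positions = site × internal
index) — its coefficients are the Taylor coefficients of `t ↦ G^ε_t` at `0⁺`, no convergence statement.  (iii) `X = 𝕂(t)` is the
whole labelled amputated 1PI insertion (all colourings, `1/n!`); print's split into `−δm² + Σ^ε + ∂^{ε*}Σ^ε_1 + Σ^{ε*}_1∂^ε +
∂^{ε*}Σ^ε_2∂^ε` and the orders in `e, λ` are a regrading/partition of `ι` not performed here; labelled graphs throughout (no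
symmetry factors).  (iv) Nothing about estimates, (1.22)–(1.23), or `ε → 0`.
(v1.1, doc-only: the two cite tags «(1.6)-(1.7) p.414» of §3 corrected to p. 413 — the displays (1.6), (1.7) are printed on
p. 413 (PDF 3 of the held text, L4–7); p. 414 opens with (1.15) — per summit-lit1 g100 P100-002; declarations byte-identical
to v1.)
-/

namespace Literature.MathematicalPhysics.QuantumFieldTheory.Balaban1983to89.B3Eq121DysonFromEq119

open Finset Literature.Probability.LatticeModels B3Eq121FirstBlock B3Eq121LabelledChains
open Literature.Probability.LatticeModels.LegDiagram (diags IsConn legs IsDiag mem_diags mem_legs)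
open B3GaussianPerturbationGraphs (present mem_present)

/-! ## §1 Attaching the two external legs: LegDiagram's connected pairings of ALL the legs (observable cluster included)
versus FILE 1's connected amputated two-point pairings `(a₁, e₁, μ)` of the vertex legs -/

section Attach

variable {Λ : Type*} [Fintype Λ] [DecidableEq Λ] {J : Type*} [Fintype J] [DecidableEq J] {own : Λ → J} {j₀ : J} {X X' : Λ}

/-- An OBSERVABLE CLUSTER `j₀` with exactly two legs `X ≠ X'` — the two external fields `φ_a(x)`, `φ_b(x′)` of the two-point
function (1.19), one cluster of the Gaussian perturbation expansion. [cite: Balaban1983Higgs3, (1.19) p.416] -/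
structure TwoLegObs (own : Λ → J) (j₀ : J) (X X' : Λ) : Prop where
  /-- `X` is a leg of the observable -/
  hX : own X = j₀
  /-- `X'` is a leg of the observable -/
  hX' : own X' = j₀
  /-- they are distinct -/
  ne : X ≠ X'
  /-- and they are all its legs -/
  only : ∀ l, own l = j₀ → l = X ∨ l = X'

/-- ATTACHING the external legs: `(a₁, e₁, μ) ↦ {{X, a₁}, {X′, e₁}} ∪ μ` — the pairing of all the legs obtained from an
amputated two-point pairing of the vertex legs by contracting `φ_a(x)` with the entry leg and `φ_b(x′)` with the exit leg.
[cite: Balaban1983Higgs3, (1.21) p.416] -/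
def attach (X X' : Λ) (x : (_ : (_ : Λ) × Λ) × Finset (Finset Λ)) : Finset (Finset Λ) :=
  insert {X, x.1.1} (insert {X', x.1.2} x.2)

/-- The index set: entry leg `a₁`, exit leg `e₁ ≠ a₁` (vertex legs), connected amputated pairing `μ` on the vertex clusters
`univ ∖ {j₀}` (FILE 1's `ampSet`, all legs active). [cite: Balaban1983Higgs3, (1.21) p.416] -/
def idx (own : Λ → J) (j₀ : J) : Finset ((_ : (_ : Λ) × Λ) × Finset (Finset Λ)) :=
  ((legsOf own univ (univ.erase j₀)).sigma fun a₁ => (legsOf own univ (univ.erase j₀)).erase a₁).sigma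
    fun x => ampSet own univ (univ.erase j₀) x.1 x.2

omit [Fintype Λ] [DecidableEq Λ] [Fintype J] [DecidableEq J] in
/-- kernel: with no external observable point, separation of `(∅, τ)` is a condition on the blocks only.
[cite: Mastropietro2008, §2.3 (2.38)] -/
theorem sep_empty_iff {τ : Finset (Finset Λ)} {Q : Finset (Option J)} :
    LegDiagram.Sep own ((∅ : Finset Λ), τ) Q ↔ ∀ B ∈ τ, (∀ l ∈ B, some (own l) ∈ Q) ∨ (∀ l ∈ B, some (own l) ∉ Q) := by
  simp [LegDiagram.Sep]

omit [Fintype Λ] [DecidableEq Λ] in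
/-- kernel: separation is symmetric under complement in the family of all clusters. [cite: Mastropietro2008, §2.3 (2.38)] -/
theorem sep_compl {τ : Finset (Finset Λ)} {Q : Finset (Option J)} (hs : LegDiagram.Sep own ((∅ : Finset Λ), τ) Q) :
    LegDiagram.Sep own ((∅ : Finset Λ), τ) (((univ : Finset J).map Function.Embedding.some) \ Q) := by
  rw [sep_empty_iff] at hs ⊢
  intro B hB
  rcases hs B hB with h1 | h1
  · exact Or.inr fun l hl h2 => (mem_sdiff.1 h2).2 (h1 l hl)
  · exact Or.inl fun l hl => mem_sdiff.2 ⟨mem_map_of_mem _ (mem_univ _), h1 l hl⟩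

omit [DecidableEq Λ] in
/-- kernel: every leg is a leg of the family of all clusters. [cite: Mastropietro2008, §2.3 (2.38)] -/
theorem legs_allV : legs own ((univ : Finset J).map Function.Embedding.some) = (univ : Finset Λ) := by
  ext l; simp

omit [Fintype Λ] [DecidableEq Λ] [Fintype J] [DecidableEq J] in
/-- kernel: `some j ∈ S.map some ↔ j ∈ S`. [folklore] [cite: Mastropietro2008, §2.3 (2.38)] -/
theorem some_mem_map_iff {S : Finset J} {j : J} : some j ∈ S.map Function.Embedding.some ↔ j ∈ S := by
  simp

omit [DecidableEq Λ] [Fintype J] in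
/-- kernel: with all legs active, the legs of a vertex set `S` are the legs owned in `S`. [cite: Balaban1983Higgs3, (1.21) p.416] -/
theorem mem_legsOf_univ {S : Finset J} {l : Λ} : l ∈ legsOf own univ S ↔ own l ∈ S := by
  simp [mem_legsOf]

/-- [cite: Balaban1983Higgs3, (1.21) p.416] -/
theorem mem_idx {x : (_ : (_ : Λ) × Λ) × Finset (Finset Λ)} :
    x ∈ idx own j₀ ↔ x.1.1 ∈ legsOf own univ (univ.erase j₀) ∧ x.1.2 ∈ (legsOf own univ (univ.erase j₀)).erase x.1.1 ∧
      x.2 ∈ ampSet own univ (univ.erase j₀) x.1.1 x.1.2 := by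
  simp only [idx, mem_sigma, and_assoc]

omit [Fintype Λ] in
/-- kernel: the block of a perfect pairing through a leg `x` is `{x, y}` with `y ≠ x`. [cite: Balaban1983Higgs3, p.414] -/
theorem exists_block_eq_pair {T : Finset Λ} {τ : Finset (Finset Λ)} (hτ : IsPM T τ) {x : Λ} (hx : x ∈ T) :
    ∃ y, y ≠ x ∧ Probability.LatticeModels.blockOf τ x = {x, y} := by
  have hP := hτ.1.blockOf_mem hx
  have hxP := hτ.1.mem_blockOf hx
  obtain ⟨u, v, huv, huv'⟩ := card_eq_two.1 (hτ.2 _ hP)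
  rw [huv'] at hxP
  simp only [mem_insert, mem_singleton] at hxP
  rcases hxP with rfl | rfl
  · exact ⟨v, huv.symm, huv'⟩
  · exact ⟨u, huv, by rw [huv', pair_comm]⟩

namespace TwoLegObs

variable (h : TwoLegObs own j₀ X X')
include h

omit [DecidableEq Λ] in
/-- kernel: the vertex legs are the legs other than `X`, `X′`. [cite: Balaban1983Higgs3, (1.21) p.416] -/
theorem mem_legs_iff {l : Λ} : l ∈ legsOf own univ (univ.erase j₀) ↔ l ≠ X ∧ l ≠ X' := by
  simp only [mem_legsOf, mem_univ, true_and, mem_erase, ne_eq, and_true]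
  constructor
  · intro hl
    exact ⟨fun h1 => hl (h1 ▸ h.hX), fun h1 => hl (h1 ▸ h.hX')⟩
  · rintro ⟨h1, h2⟩ hl
    rcases h.only l hl with h3 | h3
    · exact h1 h3
    · exact h2 h3

omit [DecidableEq Λ] in
/-- [cite: Balaban1983Higgs3, (1.21) p.416] -/
theorem X_notMem : X ∉ legsOf own univ (univ.erase j₀) := fun hl => (h.mem_legs_iff.1 hl).1 rfl

omit [DecidableEq Λ] in
/-- [cite: Balaban1983Higgs3, (1.21) p.416] -/
theorem X'_notMem : X' ∉ legsOf own univ (univ.erase j₀) := fun hl => (h.mem_legs_iff.1 hl).2 rfl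

/-- **Attaching gives a perfect pairing of all the legs.** [cite: Balaban1983Higgs3, (1.21) p.416] -/
theorem isPM_attach {a₁ e₁ : Λ} {μ : Finset (Finset Λ)} (ha : a₁ ∈ legsOf own univ (univ.erase j₀))
    (he : e₁ ∈ (legsOf own univ (univ.erase j₀)).erase a₁) (hμ : IsPM (legsOf own univ (univ.erase j₀) \ {a₁, e₁}) μ) :
    IsPM (univ : Finset Λ) (insert {X, a₁} (insert {X', e₁} μ)) := by
  have hXa : X ≠ a₁ := fun h1 => h.X_notMem (h1 ▸ ha)
  have hX'e : X' ≠ e₁ := fun h1 => h.X'_notMem (h1 ▸ mem_of_mem_erase he)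
  have he' := mem_of_mem_erase he
  -- the two set identities
  have hd₂ : Disjoint ({X', e₁} : Finset Λ) (legsOf own univ (univ.erase j₀) \ {a₁, e₁}) := by
    rw [disjoint_iff_ne]
    rintro l hl l' hl' rfl
    simp only [mem_insert, mem_singleton] at hl
    rcases hl with rfl | rfl
    · exact h.X'_notMem (mem_sdiff.1 hl').1
    · exact (mem_sdiff.1 hl').2 (by simp)
  have hd₁ : Disjoint ({X, a₁} : Finset Λ) ({X', e₁} ∪ (legsOf own univ (univ.erase j₀) \ {a₁, e₁})) := by
    rw [disjoint_iff_ne]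
    rintro l hl l' hl' rfl
    simp only [mem_insert, mem_singleton] at hl
    rcases hl with rfl | rfl
    · rcases mem_union.1 hl' with h1 | h1
      · simp only [mem_insert, mem_singleton] at h1
        rcases h1 with h1 | h1
        · exact h.ne h1
        · exact h.X_notMem (h1 ▸ he')
      · exact h.X_notMem (mem_sdiff.1 h1).1
    · rcases mem_union.1 hl' with h1 | h1
      · simp only [mem_insert, mem_singleton] at h1
        rcases h1 with h1 | h1
        · exact h.X'_notMem (h1 ▸ ha)
        · exact (mem_erase.1 he).1 h1.symm
      · exact (mem_sdiff.1 h1).2 (by simp)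
  have huniv : (univ : Finset Λ) = {X, a₁} ∪ ({X', e₁} ∪ (legsOf own univ (univ.erase j₀) \ {a₁, e₁})) := by
    ext l
    simp only [mem_univ, mem_union, mem_insert, mem_singleton, mem_sdiff, h.mem_legs_iff, true_iff]
    tauto
  refine ⟨?_, fun P hP => ?_⟩
  · rw [huniv]
    refine IsSetPartition.insert ?_ subset_union_left ⟨X, by simp⟩
    rw [union_sdiff_cancel_left hd₁]
    refine IsSetPartition.insert ?_ subset_union_left ⟨X', by simp⟩
    rw [union_sdiff_cancel_left hd₂]
    exact hμ.1
  · rcases mem_insert.1 hP with rfl | hP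
    · exact card_pair hXa
    · rcases mem_insert.1 hP with rfl | hP
      · exact card_pair hX'e
      · exact hμ.2 P hP

/-- **CONNECTED ⇒ CONNECTED**: attaching the external legs to a connected amputated pairing gives a diagram connected in
LegDiagram's sense (only `∅` and the whole family separate it). [cite: Balaban1983Higgs3, p.415] [cite: Mastropietro2008, §2.3 (2.38)] -/
theorem isConn_attach {a₁ e₁ : Λ} {μ : Finset (Finset Λ)} (hμ : IsPM (legsOf own univ (univ.erase j₀) \ {a₁, e₁}) μ)
    (hc : Conn own univ (univ.erase j₀) a₁ μ) :
    IsConn own ((univ : Finset J).map Function.Embedding.some) ((∅ : Finset Λ), insert {X, a₁} (insert {X', e₁} μ)) := by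
  set τ := insert {X, a₁} (insert {X', e₁} μ) with hτ
  have key : ∀ Q, Q ⊆ (univ : Finset J).map Function.Embedding.some → LegDiagram.Sep own ((∅ : Finset Λ), τ) Q →
      some j₀ ∉ Q → Q = ∅ := by
    intro Q hQV hsep hj₀
    rw [sep_empty_iff] at hsep
    by_contra hne
    obtain ⟨q, hq⟩ := nonempty_iff_ne_empty.2 hne
    obtain ⟨j, -, rfl⟩ := mem_map.1 (hQV hq)
    have hS : present Q ∈ (univ.erase j₀ : Finset J).powerset :=
      mem_powerset.2 fun i hi => mem_erase.2 ⟨fun h0 => hj₀ (h0 ▸ mem_present.1 hi), mem_univ _⟩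
    have hSne : (present Q).Nonempty := ⟨j, mem_present.2 hq⟩
    have haS : own a₁ ∉ present Q := by
      intro haS
      rcases hsep _ (mem_insert_self _ _) with hin | hout
      · exact hj₀ (h.hX ▸ hin X (by simp))
      · exact hout a₁ (by simp) (mem_present.1 haS)
    obtain ⟨P, hPμ, hP1⟩ := hc _ hS hSne haS
    have hPτ : P ∈ τ := mem_insert_of_mem (mem_insert_of_mem hPμ)
    obtain ⟨u, v, huv, rfl⟩ := card_eq_two.1 (hμ.2 P hPμ)
    rw [card_pair_inter_eq_one_iff huv, mem_legsOf_univ, mem_legsOf_univ, mem_present, mem_present] at hP1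
    rcases hsep _ hPτ with hin | hout
    · exact hP1.1 (hin u (by simp)) (hin v (by simp))
    · exact hout u (by simp) (hP1.2 (hout v (by simp)))
  intro Q hQ hsep
  have hQV := mem_powerset.1 hQ
  by_cases hj₀ : some j₀ ∈ Q
  · right
    have h0 : some j₀ ∉ ((univ : Finset J).map Function.Embedding.some) \ Q := fun h1 => (mem_sdiff.1 h1).2 hj₀
    have hc' := key _ sdiff_subset (sep_compl hsep) h0
    exact Subset.antisymm hQV (sdiff_eq_empty_iff_subset.1 hc')
  · exact Or.inl (key Q hQV hsep hj₀)

/-- **CONNECTED ⇐ CONNECTED** (even vertex degrees): if the attached diagram is connected in LegDiagram's sense, the amputated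
pairing is connected in FILE 1's sense — a vertex set not containing the entry vertex is left by an internal line (by
parity if it contains the exit vertex, by non-separation otherwise). [cite: Balaban1983Higgs3, p.415] [cite: Mastropietro2008, §2.3 (2.38)] -/
theorem conn_of_isConn_attach (hdeg : ∀ v ∈ (univ : Finset J).erase j₀, Even ((univ : Finset Λ).filter fun l => own l = v).card)
    {a₁ e₁ : Λ} {μ : Finset (Finset Λ)} (ha : a₁ ∈ legsOf own univ (univ.erase j₀))
    (he : e₁ ∈ (legsOf own univ (univ.erase j₀)).erase a₁) (hμ : IsPM (legsOf own univ (univ.erase j₀) \ {a₁, e₁}) μ)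
    (hc : IsConn own ((univ : Finset J).map Function.Embedding.some) ((∅ : Finset Λ), insert {X, a₁} (insert {X', e₁} μ))) :
    Conn own univ (univ.erase j₀) a₁ μ := by
  have hamp : IsAmp own univ (univ.erase j₀) e₁ a₁ μ :=
    ⟨mem_of_mem_erase he, ha, (mem_erase.1 he).1, by rw [pair_comm]; exact hμ⟩
  intro S hS hSne haS
  have hSU := mem_powerset.1 hS
  by_cases heS : own e₁ ∈ S
  · exact exists_cross_of_mem_of_notMem hamp hdeg hSU heS haS
  by_contra hno
  push Not at hno
  have hj₀S : j₀ ∉ S := fun h1 => (mem_erase.1 (hSU h1)).1 rfl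
  -- `S` separates the attached diagram
  have hsep : LegDiagram.Sep own ((∅ : Finset Λ), insert {X, a₁} (insert {X', e₁} μ)) (S.map Function.Embedding.some) := by
    rw [sep_empty_iff]
    intro B hB
    rcases mem_insert.1 hB with rfl | hB
    · refine Or.inr fun l hl h1 => ?_
      rw [some_mem_map_iff] at h1
      simp only [mem_insert, mem_singleton] at hl
      rcases hl with rfl | rfl
      · exact hj₀S (h.hX ▸ h1)
      · exact haS h1
    rcases mem_insert.1 hB with rfl | hB
    · refine Or.inr fun l hl h1 => ?_
      rw [some_mem_map_iff] at h1
      simp only [mem_insert, mem_singleton] at hl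
      rcases hl with rfl | rfl
      · exact hj₀S (h.hX' ▸ h1)
      · exact heS h1
    obtain ⟨u, v, huv, rfl⟩ := card_eq_two.1 (hμ.2 B hB)
    have h1 := hno _ hB
    rw [Ne, card_pair_inter_eq_one_iff huv, mem_legsOf_univ, mem_legsOf_univ] at h1
    by_cases hu : own u ∈ S
    · refine Or.inl fun l hl => ?_
      rw [some_mem_map_iff]
      simp only [mem_insert, mem_singleton] at hl
      rcases hl with rfl | rfl
      · exact hu
      · by_contra hv; exact h1 ⟨fun _ => hv, fun _ => hu⟩
    · refine Or.inr fun l hl hl' => ?_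
      rw [some_mem_map_iff] at hl'
      simp only [mem_insert, mem_singleton] at hl
      rcases hl with rfl | rfl
      · exact hu hl'
      · exact h1 ⟨fun hu' => (hu hu').elim, fun hnv => (hnv hl').elim⟩
  rcases hc _ (mem_powerset.2 fun q hq => by
      obtain ⟨j, -, rfl⟩ := mem_map.1 hq; exact mem_map_of_mem _ (mem_univ j)) hsep with h0 | h0
  · obtain ⟨j, hj⟩ := hSne
    rw [eq_empty_iff_forall_notMem] at h0
    exact h0 (some j) (mem_map_of_mem _ hj)
  · have : some j₀ ∈ S.map Function.Embedding.some := h0 ▸ mem_map_of_mem _ (mem_univ j₀)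
    rw [some_mem_map_iff] at this
    exact hj₀S this

/-- kernel: the blocks of an amputated pairing avoid `X`. [cite: Balaban1983Higgs3, (1.21) p.416] -/
theorem X_notMem_of_mem {a₁ e₁ : Λ} {μ : Finset (Finset Λ)} (hμ : IsPM (legsOf own univ (univ.erase j₀) \ {a₁, e₁}) μ)
    {P : Finset Λ} (hP : P ∈ μ) : X ∉ P :=
  fun hX => h.X_notMem (mem_sdiff.1 (hμ.1.subset hP hX)).1

/-- kernel: the blocks of an amputated pairing avoid `X′`. [cite: Balaban1983Higgs3, (1.21) p.416] -/
theorem X'_notMem_of_mem {a₁ e₁ : Λ} {μ : Finset (Finset Λ)} (hμ : IsPM (legsOf own univ (univ.erase j₀) \ {a₁, e₁}) μ)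
    {P : Finset Λ} (hP : P ∈ μ) : X' ∉ P :=
  fun hX => h.X'_notMem (mem_sdiff.1 (hμ.1.subset hP hX)).1

/-- kernel: the entry line is a new block. [cite: Balaban1983Higgs3, (1.21) p.416] -/
theorem pairX_notMem {a₁ e₁ : Λ} {μ : Finset (Finset Λ)} (he : e₁ ∈ legsOf own univ (univ.erase j₀))
    (hμ : IsPM (legsOf own univ (univ.erase j₀) \ {a₁, e₁}) μ) (a : Λ) : ({X, a} : Finset Λ) ∉ insert {X', e₁} μ := by
  intro h1
  rcases mem_insert.1 h1 with h1 | h1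
  · have : X ∈ ({X', e₁} : Finset Λ) := h1 ▸ mem_insert_self _ _
    simp only [mem_insert, mem_singleton] at this
    rcases this with h2 | h2
    · exact h.ne h2
    · exact h.X_notMem (h2 ▸ he)
  · exact h.X_notMem_of_mem hμ h1 (mem_insert_self _ _)

/-- kernel: the exit line is a new block. [cite: Balaban1983Higgs3, (1.21) p.416] -/
theorem pairX'_notMem {a₁ e₁ : Λ} {μ : Finset (Finset Λ)} (hμ : IsPM (legsOf own univ (univ.erase j₀) \ {a₁, e₁}) μ)
    (e : Λ) : ({X', e} : Finset Λ) ∉ μ :=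
  fun h1 => h.X'_notMem_of_mem hμ h1 (mem_insert_self _ _)

/-- **The value of the attached pairing** = entry propagator · exit propagator · value of the amputated pairing.
[cite: Balaban1983Higgs3, (1.21) p.416] -/
theorem prod_attach {R : Type*} [CommMonoid R] (w : Finset Λ → R) {a₁ e₁ : Λ} {μ : Finset (Finset Λ)}
    (he : e₁ ∈ legsOf own univ (univ.erase j₀)) (hμ : IsPM (legsOf own univ (univ.erase j₀) \ {a₁, e₁}) μ) :
    ∏ B ∈ insert {X, a₁} (insert {X', e₁} μ), w B = w {X, a₁} * (w {X', e₁} * ∏ B ∈ μ, w B) := by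
  rw [prod_insert (h.pairX_notMem he hμ a₁), prod_insert (h.pairX'_notMem hμ e₁)]

/-- kernel: removing the two external lines recovers the amputated pairing. [cite: Balaban1983Higgs3, (1.21) p.416] -/
theorem erase_erase_attach {a₁ e₁ : Λ} {μ : Finset (Finset Λ)} (he : e₁ ∈ legsOf own univ (univ.erase j₀))
    (hμ : IsPM (legsOf own univ (univ.erase j₀) \ {a₁, e₁}) μ) :
    ((insert {X, a₁} (insert {X', e₁} μ)).erase {X, a₁}).erase {X', e₁} = μ := by
  rw [erase_insert (h.pairX_notMem he hμ a₁), erase_insert (h.pairX'_notMem hμ e₁)]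

/-- **Attaching is injective.** [cite: Balaban1983Higgs3, (1.21) p.416] -/
theorem attach_injOn : Set.InjOn (attach X X') (idx own j₀ : Set ((_ : (_ : Λ) × Λ) × Finset (Finset Λ))) := by
  intro x hx x' hx' heq
  obtain ⟨⟨a, e⟩, μ⟩ := x
  obtain ⟨⟨a', e'⟩, μ'⟩ := x'
  simp only [mem_coe, mem_idx] at hx hx'
  obtain ⟨ha, he, hμ⟩ := hx
  obtain ⟨ha', he', hμ'⟩ := hx'
  have hpm := (mem_ampSet.1 hμ).1
  have hpm' := (mem_ampSet.1 hμ').1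
  simp only [attach] at heq
  have hae : a = a' := by
    have hmem : ({X, a} : Finset Λ) ∈ insert {X, a'} (insert {X', e'} μ') := heq ▸ mem_insert_self _ _
    rcases mem_insert.1 hmem with h1 | h1
    · have : a ∈ ({X, a'} : Finset Λ) := h1 ▸ (by simp)
      simp only [mem_insert, mem_singleton] at this
      rcases this with h2 | h2
      · exact absurd (h2 ▸ ha) h.X_notMem
      · exact h2
    · exact absurd h1 (h.pairX_notMem (mem_of_mem_erase he') hpm' a)
  have hee : e = e' := by
    have hmem : ({X', e} : Finset Λ) ∈ insert {X, a'} (insert {X', e'} μ') :=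
      heq ▸ mem_insert_of_mem (mem_insert_self _ _)
    rcases mem_insert.1 hmem with h1 | h1
    · have : X' ∈ ({X, a'} : Finset Λ) := h1 ▸ (by simp)
      simp only [mem_insert, mem_singleton] at this
      rcases this with h2 | h2
      · exact absurd h2.symm h.ne
      · exact absurd (h2 ▸ ha') h.X'_notMem
    · rcases mem_insert.1 h1 with h2 | h2
      · have : e ∈ ({X', e'} : Finset Λ) := h2 ▸ (by simp)
        simp only [mem_insert, mem_singleton] at this
        rcases this with h3 | h3
        · exact absurd (h3 ▸ mem_of_mem_erase he) h.X'_notMem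
        · exact h3
      · exact absurd h2 (h.pairX'_notMem hpm' e)
  subst hae hee
  have e1 := h.erase_erase_attach (mem_of_mem_erase he) hpm
  have e2 := h.erase_erase_attach (mem_of_mem_erase he') hpm'
  rw [heq] at e1
  obtain rfl : μ = μ' := e1.symm.trans e2
  rfl

/-- **Attaching is onto the connected perfect pairings of all the legs** (at least one vertex, even vertex degrees): in a
connected pairing the partner of `φ_a(x)` is a vertex leg `a₁` (not `φ_b(x′)`: the observable alone would be a component),
the partner of `φ_b(x′)` is a vertex leg `e₁ ≠ a₁`, and the rest is a connected amputated pairing. [cite: Balaban1983Higgs3, (1.21) p.416] -/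
theorem attach_surjOn (hU : ((univ : Finset J).erase j₀).Nonempty)
    (hdeg : ∀ v ∈ (univ : Finset J).erase j₀, Even ((univ : Finset Λ).filter fun l => own l = v).card) :
    Set.SurjOn (attach X X') (idx own j₀ : Set ((_ : (_ : Λ) × Λ) × Finset (Finset Λ)))
      ((pmatchings (univ : Finset Λ)).filter fun τ =>
        IsConn own ((univ : Finset J).map Function.Embedding.some) ((∅ : Finset Λ), τ) : Set (Finset (Finset Λ))) := by
  intro τ hτ
  rw [mem_coe, mem_filter, mem_pmatchings] at hτ
  obtain ⟨hpm, hc⟩ := hτ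
  have hP := hpm.1.blockOf_mem (mem_univ X)
  have hXP := hpm.1.mem_blockOf (mem_univ X)
  obtain ⟨a₁, ha₁X, hPa⟩ := exists_block_eq_pair hpm (mem_univ X)
  -- the partner of `X` is not `X'`
  have ha₁X' : a₁ ≠ X' := by
    rintro rfl
    have hsep : LegDiagram.Sep own ((∅ : Finset Λ), τ) {some j₀} := by
      rw [sep_empty_iff]
      intro B hB
      by_cases hBP : B = Probability.LatticeModels.blockOf τ X
      · left
        intro l hl
        rw [hBP, hPa] at hl
        simp only [mem_insert, mem_singleton] at hl
        rw [mem_singleton]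
        rcases hl with rfl | rfl
        · rw [h.hX]
        · rw [h.hX']
      · right
        intro l hl h1
        rw [mem_singleton, Option.some_inj] at h1
        have hl' : l ∈ Probability.LatticeModels.blockOf τ X := by
          rw [hPa]; rcases h.only l h1 with rfl | rfl <;> simp
        exact hBP (hpm.1.eq_of_mem hB hP hl hl')
    have hQ : ({some j₀} : Finset (Option J)) ∈ ((univ : Finset J).map Function.Embedding.some).powerset :=
      mem_powerset.2 fun q hq => by rw [mem_singleton] at hq; subst hq; exact mem_map_of_mem _ (mem_univ _)
    rcases hc _ hQ hsep with h0 | h0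
    · exact absurd h0 (singleton_ne_empty _)
    · obtain ⟨j, hj⟩ := hU
      have : some j ∈ ({some j₀} : Finset (Option J)) := h0 ▸ mem_map_of_mem _ (mem_univ j)
      rw [mem_singleton, Option.some_inj] at this
      exact (mem_erase.1 hj).1 this
  have ha₁ : a₁ ∈ legsOf own univ (univ.erase j₀) := h.mem_legs_iff.2 ⟨ha₁X, ha₁X'⟩
  -- the partner of `X'`
  have hP' := hpm.1.blockOf_mem (mem_univ X')
  have hXP' := hpm.1.mem_blockOf (mem_univ X')
  obtain ⟨e₁, he₁X', hPe⟩ := exists_block_eq_pair hpm (mem_univ X')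
  have hPP' : Probability.LatticeModels.blockOf τ X ≠ Probability.LatticeModels.blockOf τ X' := by
    intro hq
    have : X' ∈ Probability.LatticeModels.blockOf τ X := hq ▸ hXP'
    rw [hPa] at this
    simp only [mem_insert, mem_singleton] at this
    rcases this with h1 | h1
    · exact h.ne h1.symm
    · exact ha₁X' h1.symm
  have he₁X : e₁ ≠ X := by
    intro h1
    have hX2 : X ∈ Probability.LatticeModels.blockOf τ X' := by rw [hPe, ← h1]; simp
    exact hPP' (hpm.1.eq_of_mem hP hP' hXP hX2)
  have he₁a : e₁ ≠ a₁ := by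
    intro h1
    have h2 : a₁ ∈ Probability.LatticeModels.blockOf τ X := by rw [hPa]; simp
    have h3 : a₁ ∈ Probability.LatticeModels.blockOf τ X' := by rw [hPe, h1]; simp
    exact hPP' (hpm.1.eq_of_mem hP hP' h2 h3)
  have he₁ : e₁ ∈ (legsOf own univ (univ.erase j₀)).erase a₁ := mem_erase.2 ⟨he₁a, h.mem_legs_iff.2 ⟨he₁X, he₁X'⟩⟩
  -- the amputated pairing
  have hP'' : Probability.LatticeModels.blockOf τ X' ∈ τ.erase (Probability.LatticeModels.blockOf τ X) := mem_erase.2 ⟨hPP'.symm, hP'⟩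
  have hτeq : τ = insert {X, a₁} (insert {X', e₁} ((τ.erase (Probability.LatticeModels.blockOf τ X)).erase (Probability.LatticeModels.blockOf τ X'))) := by
    rw [← hPa, ← hPe, insert_erase hP'', insert_erase hP]
  have hμpm : IsPM (legsOf own univ (univ.erase j₀) \ {a₁, e₁}) ((τ.erase (Probability.LatticeModels.blockOf τ X)).erase (Probability.LatticeModels.blockOf τ X')) := by
    refine ⟨?_, fun P hP₁ => hpm.2 P (mem_of_mem_erase (mem_of_mem_erase hP₁))⟩
    have hsp := (hpm.1.erase hP).erase hP''
    have hset : ((univ : Finset Λ) \ Probability.LatticeModels.blockOf τ X) \ Probability.LatticeModels.blockOf τ X' = legsOf own univ (univ.erase j₀) \ {a₁, e₁} := by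
      rw [hPa, hPe]
      ext l
      simp only [mem_sdiff, mem_univ, true_and, mem_insert, mem_singleton, h.mem_legs_iff, not_or]
      tauto
    rwa [hset] at hsp
  have hconn : Conn own univ (univ.erase j₀) a₁ ((τ.erase (Probability.LatticeModels.blockOf τ X)).erase (Probability.LatticeModels.blockOf τ X')) :=
    h.conn_of_isConn_attach hdeg ha₁ he₁ hμpm (hτeq ▸ hc)
  refine ⟨⟨⟨a₁, e₁⟩, (τ.erase (Probability.LatticeModels.blockOf τ X)).erase (Probability.LatticeModels.blockOf τ X')⟩, ?_, ?_⟩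
  · rw [mem_coe, mem_idx]
    exact ⟨ha₁, he₁, mem_ampSet.2 ⟨hμpm, hconn⟩⟩
  · exact hτeq.symm

/-- **THE SUM OVER LEGDIAGRAM'S CONNECTED GRAPHS = THE SUM OVER THE ATTACHED AMPUTATED CONNECTED PAIRINGS**: for pair
weights `w` (vanishing on blocks that are not pairs), at least one vertex and even vertex degrees,
`Σ_{g connected diagram of all clusters} Π_{B ∈ g} w B = Σ_{a₁} Σ_{e₁ ≠ a₁} w{X, a₁} · w{X′, e₁} · 𝒜_U(a₁, e₁)` with FILE 1's
`ampSum` on the vertex clusters `U = univ ∖ {j₀}` (all legs active). [cite: Balaban1983Higgs3, (1.19)-(1.21) p.416]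
[cite: Mastropietro2008, §2.3 (2.38)] -/
theorem sum_conn_diags_eq (hU : ((univ : Finset J).erase j₀).Nonempty)
    (hdeg : ∀ v ∈ (univ : Finset J).erase j₀, Even ((univ : Finset Λ).filter fun l => own l = v).card)
    {R : Type*} [CommRing R] (w : Finset Λ → R) (hw : ∀ B : Finset Λ, B.card ≠ 2 → w B = 0) :
    ∑ g ∈ (diags own ((univ : Finset J).map Function.Embedding.some)).filter
        (IsConn own ((univ : Finset J).map Function.Embedding.some)), ∏ B ∈ g.2, w B
      = ∑ a₁ ∈ legsOf own univ (univ.erase j₀), ∑ e₁ ∈ (legsOf own univ (univ.erase j₀)).erase a₁,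
          w {X, a₁} * w {X', e₁} * ampSum own univ w (univ.erase j₀) a₁ e₁ := by
  set V := (univ : Finset J).map Function.Embedding.some with hV
  have hnone : none ∉ V := by simp [hV]
  have hfst : ∀ g ∈ (diags own V).filter (IsConn own V), g.1 = ∅ := fun g hg => by
    obtain ⟨-, h2, -⟩ := (mem_diags own).1 (mem_filter.1 hg).1
    exact not_nonempty_iff_eq_empty.1 fun hne => hnone (h2 hne)
  -- (a) diagrams ↦ their pairing
  have step1 : ∑ g ∈ (diags own V).filter (IsConn own V), ∏ B ∈ g.2, w B
      = ∑ τ ∈ (setPartitions (univ : Finset Λ)).filter (fun τ => IsConn own V ((∅ : Finset Λ), τ)), ∏ B ∈ τ, w B := by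
    refine sum_nbij' (fun g => g.2) (fun τ => ((∅ : Finset Λ), τ)) (fun g hg => ?_) (fun τ hτ => ?_)
      (fun g hg => ?_) (fun τ _ => rfl) (fun g _ => rfl)
    · have he := hfst g hg
      obtain ⟨hg, hcg⟩ := mem_filter.1 hg
      obtain ⟨-, -, h3⟩ := (mem_diags own).1 hg
      rw [he, sdiff_empty, legs_allV] at h3
      refine mem_filter.2 ⟨mem_setPartitions.2 h3, ?_⟩
      have : g = ((∅ : Finset Λ), g.2) := Prod.ext he rfl
      rw [← this]; exact hcg
    · obtain ⟨hτ, hc⟩ := mem_filter.1 hτ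
      refine mem_filter.2 ⟨(mem_diags own).2 ⟨empty_subset _, fun hne => absurd hne not_nonempty_empty, ?_⟩, hc⟩
      rw [sdiff_empty, legs_allV]; exact mem_setPartitions.1 hτ
    · exact (show ((∅ : Finset Λ), g.2) = g from Prod.ext (hfst g hg).symm rfl)
  -- (b) only perfect pairings weigh
  have step2 : ∑ τ ∈ (setPartitions (univ : Finset Λ)).filter (fun τ => IsConn own V ((∅ : Finset Λ), τ)), ∏ B ∈ τ, w B
      = ∑ τ ∈ (pmatchings (univ : Finset Λ)).filter (fun τ => IsConn own V ((∅ : Finset Λ), τ)), ∏ B ∈ τ, w B := by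
    symm
    refine sum_subset (fun τ hτ => ?_) (fun τ hτ hτ' => ?_)
    · obtain ⟨hτ, hc⟩ := mem_filter.1 hτ
      exact mem_filter.2 ⟨mem_setPartitions.2 (mem_pmatchings.1 hτ).1, hc⟩
    · obtain ⟨hτ, hc⟩ := mem_filter.1 hτ
      have : ¬ ∀ P ∈ τ, P.card = 2 := fun hall =>
        hτ' (mem_filter.2 ⟨mem_pmatchings.2 ⟨mem_setPartitions.1 hτ, hall⟩, hc⟩)
      push Not at this
      obtain ⟨P, hP, hPc⟩ := this
      exact prod_eq_zero hP (hw P hPc)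
  rw [step1, step2]
  symm
  rw [show ∑ a₁ ∈ legsOf own univ (univ.erase j₀), ∑ e₁ ∈ (legsOf own univ (univ.erase j₀)).erase a₁,
      w {X, a₁} * w {X', e₁} * ampSum own univ w (univ.erase j₀) a₁ e₁
      = ∑ x ∈ idx own j₀, w {X, x.1.1} * (w {X', x.1.2} * ∏ B ∈ x.2, w B) by
    rw [idx, sum_sigma, sum_sigma]
    refine sum_congr rfl fun a₁ _ => sum_congr rfl fun e₁ _ => ?_
    rw [ampSum, mul_sum]
    exact sum_congr rfl fun μ _ => by ring]
  refine sum_nbij (attach X X') (fun x hx => ?_) h.attach_injOn (h.attach_surjOn hU hdeg) (fun x hx => ?_)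
  · rw [mem_idx] at hx
    obtain ⟨ha, he, hμ⟩ := hx
    obtain ⟨hpm, hc⟩ := mem_ampSet.1 hμ
    exact mem_filter.2 ⟨mem_pmatchings.2 (h.isPM_attach ha he hpm), h.isConn_attach hpm hc⟩
  · rw [mem_idx] at hx
    obtain ⟨-, he, hμ⟩ := hx
    exact (h.prod_attach w (mem_of_mem_erase he) (mem_ampSet.1 hμ).1).symm

end TwoLegObs

end Attach

/-! ## §2 Evaluating `Y · 𝒜_U · Z` and the propagator as a pair weight -/

section Eval

variable {Λ : Type*} [DecidableEq Λ] {V : Type*} [DecidableEq V] {R : Type*} [CommRing R] {S : Type*} [Fintype S]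
  [DecidableEq S]

/-- **`(Y · 𝒜_U · Z)(p, q) = Σ_{a} Σ_{e ≠ a} Y(p, pos a) · 𝒜_U(a, e) · Z(pos e, q)`** — dressing the amputated matrix with two
external propagators. [cite: Balaban1983Higgs3, (1.21) p.416] -/
theorem mul_ampMat_mul_apply (own : Λ → V) (A : Finset Λ) (w : Finset Λ → R) (pos : Λ → S) (U : Finset V)
    (Y Z : Matrix S S R) (p q : S) :
    (Y * ampMat own A w pos U * Z) p q
      = ∑ a ∈ legsOf own A U, ∑ e ∈ (legsOf own A U).erase a, Y p (pos a) * ampSum own A w U a e * Z (pos e) q := by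
  rw [Matrix.mul_apply]
  simp only [ampMat, mul_posMat_apply, sum_mul]
  rw [sum_comm]
  refine sum_congr rfl fun a _ => ?_
  simp only [mul_assoc, ← mul_sum]
  rw [sum_posVec_mul, mul_sum]

end Eval

/-! ## §3 The `(Higgs)₂,₃` vertex data of (1.20) at `e = 0` and the free propagator as a matrix on positions -/

section HiggsData

open B3Eq119ConnectedGraphs HiggsLattice

variable {P : HiggsLattice.Params} {k N : ℕ}

/-- the colours of (1.6)–(1.7) have at most four legs. [cite: Balaban1983Higgs3, (1.6)-(1.7) p.413] -/
theorem cdeg_le_four (c : Colour P k N) : cdeg c ≤ 4 := by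
  rcases c with _ | _ | _ <;> simp [cdeg]

/-- the colours of (1.6)–(1.7) (and the observable `φ_a(x)φ_b(x′)`) have an even number of legs.
[cite: Balaban1983Higgs3, (1.6)-(1.7) p.413] -/
theorem cdeg_even (c : Colour P k N) : Even (cdeg c) := by
  rcases c with _ | _ | _
  exacts [⟨1, rfl⟩, ⟨2, rfl⟩, ⟨1, rfl⟩]

/-- The vertex coefficients `−λε^d` (quartic colour) and `−½δm²ε^d` (mass colour), cluster-index free (`0` on the observable
colour). [cite: Balaban1983Higgs3, (1.20) p.416] -/
noncomputable def vcoef (ηd lam dm2 : ℝ) : Colour P k N → ℝ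
  | .inl _ => 0
  | .inr (.inl _) => -(ηd * lam)
  | .inr (.inr _) => -(ηd * (dm2 / 2))

/-- kernel: BRICK 5's `ccoef` on a vertex cluster is `vcoef`. [cite: Balaban1983Higgs3, (1.20) p.416] -/
theorem ccoef_some (ηd lam dm2 : ℝ) {n : ℕ} (i : Fin n) (c : Colour P k N) :
    ccoef ηd lam dm2 (some i) c = vcoef ηd lam dm2 c := by
  rcases c with _ | _ | _ <;> rfl

/-- **THE VERTEX DATA OF (1.20) at `e = 0`** for FILE 2's labelled machine: vertex colours = the quartic (1.6) and mass (1.7)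
colours at all points and internal indices (`univ.map inr`, BRICK 5's `cK (some _)`), spare colour = the observable colour,
degrees `cdeg`, leg positions `legPos` (site, internal index), coefficients `vcoef`. [cite: Balaban1983Higgs3, (1.20) p.416] -/
noncomputable def higgsVD (ηd lam dm2 : ℝ) (a b : Fin N) (x x' : HiggsLattice.Site P k) :
    VertexData (Colour P k N) (HiggsLattice.Site P k × Fin N) ℝ 4 where
  Kv := univ.map ⟨Sum.inr, Sum.inr_injective⟩
  c₀ := Sum.inl ()
  deg := cdeg
  deg_le := cdeg_le_four
  deg_even := fun c _ => cdeg_even c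
  lpos := fun c i => legPos a b x x' c i
  coef := vcoef ηd lam dm2

/-- **THE FREE PROPAGATOR AS A MATRIX ON POSITIONS**: `C0 (y,c) (y′,c′) = C₀(y,c;y′,c′) = ⟨φ_c(y)φ_{c′}(y′)⟩₀` (BRICK 5's `prop0`).
[cite: Balaban1983Higgs3, (1.21) p.416] -/
noncomputable def C0 (P : HiggsLattice.Params) (k N : ℕ) (C : ChargeData N) (msq mu0sq : ℝ) :
    Matrix (HiggsLattice.Site P k × Fin N) (HiggsLattice.Site P k × Fin N) ℝ :=
  fun p q => prop0 P k N C msq mu0sq p.1 p.2 q.1 q.2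

/-- `C₀` is symmetric. [cite: Balaban1983Higgs3, (1.21) p.416] -/
theorem C0_isSymm (C : ChargeData N) (msq mu0sq : ℝ) : (C0 P k N C msq mu0sq).IsSymm :=
  Matrix.IsSymm.ext fun p q => prop0_symm C msq mu0sq q.1 q.2 p.1 p.2

end HiggsData

/-! ## §4 One colouring: BRICK 5's connected-graph sum is `(C₀ · 𝒜_z · C₀)(x,a; x′,b)` on FILE 2's universal carrier -/

section Colouring

open B3Eq119ConnectedGraphs B3GaussianPerturbationGraphs HiggsLattice

variable {P : HiggsLattice.Params} {k N n : ℕ} (a b : Fin N) (x x' : HiggsLattice.Site P k)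
  {z : Option (Fin n) → Colour P k N}

/-- The leg `φ_a(x)` of the observable cluster. [cite: Balaban1983Higgs3, (1.19) p.416] -/
def legX (hz : z none = Sum.inl ()) : Leg cdeg z := ⟨none, ⟨0, by rw [hz]; exact Nat.two_pos⟩⟩

/-- The leg `φ_b(x′)` of the observable cluster. [cite: Balaban1983Higgs3, (1.19) p.416] -/
def legX' (hz : z none = Sum.inl ()) : Leg cdeg z := ⟨none, ⟨1, by rw [hz]; exact Nat.one_lt_two⟩⟩

/-- the observable cluster `none` has exactly the two legs `φ_a(x)`, `φ_b(x′)`. [cite: Balaban1983Higgs3, (1.19) p.416] -/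
theorem twoLegObs (hz : z none = Sum.inl ()) :
    TwoLegObs (Sigma.fst : Leg cdeg z → Option (Fin n)) none (legX hz) (legX' hz) where
  hX := rfl
  hX' := rfl
  ne := fun h => by
    have := congrArg (fun l : Leg cdeg z => (l.2 : ℕ)) h
    simp [legX, legX'] at this
  only := by
    rintro ⟨j, i⟩ (rfl : j = none)
    have h2 : cdeg (z none) = 2 := by rw [hz]; rfl
    have hi : (i : ℕ) < 2 := i.2.trans_eq h2
    rcases Nat.lt_succ_iff_lt_or_eq.1 hi with h1 | h1
    · left
      exact Sigma.ext rfl (heq_of_eq (Fin.ext (by simpa [legX] using Nat.lt_one_iff.1 h1)))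
    · right
      exact Sigma.ext rfl (heq_of_eq (Fin.ext (by simpa [legX'] using h1)))

omit a b x x' in
/-- kernel: the cluster `j` owns `cdeg (z j)` legs. [cite: Balaban1983Higgs3, (1.20) p.416] -/
theorem card_fiber_leg (z : Option (Fin n) → Colour P k N) (j : Option (Fin n)) :
    ((univ : Finset (Leg cdeg z)).filter fun l => l.1 = j).card = cdeg (z j) := by
  rw [show ((univ : Finset (Leg cdeg z)).filter fun l => l.1 = j) = ({j} : Finset (Option (Fin n))).sigma fun j => univ by
    ext ⟨j', i⟩; simp [eq_comm]]
  simp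

/-- The positions of the legs of a colouring (BRICK 5's `legPos`). [cite: Balaban1983Higgs3, (1.20) p.416] -/
def posL (z : Option (Fin n) → Colour P k N) (l : Leg cdeg z) : HiggsLattice.Site P k × Fin N :=
  legPos a b x x' (z l.1) l.2

/-- kernel: `φ_a(x)` sits at `(x, a)`. [cite: Balaban1983Higgs3, (1.19) p.416] -/
theorem posL_legX (hz : z none = Sum.inl ()) : posL a b x x' z (legX hz) = (x, a) := by
  simp only [posL, legX]; rw [hz]; simp [legPos]

/-- kernel: `φ_b(x′)` sits at `(x′, b)`. [cite: Balaban1983Higgs3, (1.19) p.416] -/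
theorem posL_legX' (hz : z none = Sum.inl ()) : posL a b x x' z (legX' hz) = (x', b) := by
  simp only [posL, legX']; rw [hz]; simp [legPos]

variable (C : ChargeData N) (msq mu0sq : ℝ)

/-- **BRICK 5's pair weight is FILE 2's propagator pair weight**: `pairW {l, l′} = pw C₀ posL {l, l′} = C₀(pos l, pos l′)`, and
both vanish on blocks that are not pairs. [cite: Balaban1983Higgs3, (1.21) p.416] -/
theorem pw_eq_pairW (he : C.e = 0) (hm : 0 < msq) (hmu : 0 < mu0sq) (z : Option (Fin n) → Colour P k N)
    (B : Finset (Leg cdeg z)) :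
    pw (C0 P k N C msq mu0sq) (posL a b x x' z) B = pairW (precMat (P := P) (k := k) C msq) (legVec cdeg (clv a b x x') z) B := by
  by_cases hB : B.card = 2
  · obtain ⟨l, l', hne, rfl⟩ := card_eq_two.1 hB
    rw [pw_pair (C0_isSymm C msq mu0sq) hne, pairW_legs C he hm hmu z hne, posL, posL, C0]
  · rw [pw_of_card_ne_two hB, pairW_of_card_ne_two _ hB]

/-- **ONE COLOURING**: for a colouring `z` of `n ≥ 1` vertices (observable colour on the cluster `none`), BRICK 5's sum over the
CONNECTED LegDiagram graphs of `Π pairW` equals `(C₀ · 𝒜 · C₀)((x,a),(x′,b))` with FILE 1/2's amputated connected matrix `𝒜` of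
the vertex clusters on the carrier `Leg cdeg z` (all legs active). [cite: Balaban1983Higgs3, (1.19)-(1.21) p.416] -/
theorem sum_conn_eq_mul_ampMat_mul (he : C.e = 0) (hm : 0 < msq) (hmu : 0 < mu0sq) (hn : n ≠ 0)
    (hz : z none = Sum.inl ()) :
    ∑ g ∈ (diags (Sigma.fst : Leg cdeg z → Option (Fin n)) ((univ : Finset (Option (Fin n))).map Function.Embedding.some)).filter
        (IsConn (Sigma.fst : Leg cdeg z → Option (Fin n)) ((univ : Finset (Option (Fin n))).map Function.Embedding.some)),
        ∏ B ∈ g.2, pairW (precMat (P := P) (k := k) C msq) (legVec cdeg (clv a b x x') z) B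
      = (C0 P k N C msq mu0sq * ampMat Sigma.fst univ (pw (C0 P k N C msq mu0sq) (posL a b x x' z)) (posL a b x x' z)
          (univ.erase none) * C0 P k N C msq mu0sq) (x, a) (x', b) := by
  have hU : ((univ : Finset (Option (Fin n))).erase none).Nonempty :=
    ⟨some ⟨0, Nat.pos_of_ne_zero hn⟩, mem_erase.2 ⟨Option.some_ne_none _, mem_univ _⟩⟩
  have hdeg : ∀ v ∈ (univ : Finset (Option (Fin n))).erase none,
      Even ((univ : Finset (Leg cdeg z)).filter fun l => l.1 = v).card := fun v _ => by
    rw [card_fiber_leg]; exact cdeg_even _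
  rw [(twoLegObs hz).sum_conn_diags_eq hU hdeg (pairW (precMat (P := P) (k := k) C msq) (legVec cdeg (clv a b x x') z))
    (fun B hB => pairW_of_card_ne_two _ hB), mul_ampMat_mul_apply]
  refine sum_congr rfl fun a₁ ha₁ => sum_congr rfl fun e₁ he₁ => ?_
  have hXa : legX hz ≠ a₁ := fun h1 => (twoLegObs hz).X_notMem (h1 ▸ ha₁)
  have hX'e : legX' hz ≠ e₁ := fun h1 => (twoLegObs hz).X'_notMem (h1 ▸ mem_of_mem_erase he₁)
  have h1 : pairW (precMat (P := P) (k := k) C msq) (legVec cdeg (clv a b x x') z) {legX hz, a₁}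
      = C0 P k N C msq mu0sq (x, a) (posL a b x x' z a₁) := by
    rw [← pw_eq_pairW a b x x' C msq mu0sq he hm hmu z, pw_pair (C0_isSymm C msq mu0sq) hXa, posL_legX]
  have h2 : pairW (precMat (P := P) (k := k) C msq) (legVec cdeg (clv a b x x') z) {legX' hz, e₁}
      = C0 P k N C msq mu0sq (x', b) (posL a b x x' z e₁) := by
    rw [← pw_eq_pairW a b x x' C msq mu0sq he hm hmu z, pw_pair (C0_isSymm C msq mu0sq) hX'e, posL_legX']
  have h3 : ampSum Sigma.fst univ (pairW (precMat (P := P) (k := k) C msq) (legVec cdeg (clv a b x x') z))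
        ((univ : Finset (Option (Fin n))).erase none) a₁ e₁
      = ampSum Sigma.fst univ (pw (C0 P k N C msq mu0sq) (posL a b x x' z)) ((univ : Finset (Option (Fin n))).erase none)
          a₁ e₁ :=
    ampSum_congr (fun _ _ => Iff.rfl) (fun B _ => (pw_eq_pairW a b x x' C msq mu0sq he hm hmu z B).symm) a₁ e₁
  rw [h1, h2, h3, (C0_isSymm C msq mu0sq).apply (x', b) (posL a b x x' z e₁)]
  ring

/-! ### §5 Transport to FILE 2's universal carrier `Fin n × Fin 4` -/

/-- The leg positions on the common carrier `Option (Fin n) × Fin 4`. [cite: Balaban1983Higgs3, (1.20) p.416] -/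
def posO (z : Option (Fin n) → Colour P k N) (l : Option (Fin n) × Fin 4) : HiggsLattice.Site P k × Fin N :=
  legPos a b x x' (z l.1) l.2

omit a b x x' in
/-- The legs of a colouring embed into the common carrier `Option (Fin n) × Fin 4`. [cite: Balaban1983Higgs3, (1.20) p.416] -/
def embLeg (z : Option (Fin n) → Colour P k N) : Leg cdeg z ↪ Option (Fin n) × Fin 4 :=
  ⟨fun l => (l.1, Fin.castLE (cdeg_le_four (z l.1)) l.2), by
    rintro ⟨j, i⟩ ⟨j', i'⟩ h
    simp only [Prod.mk.injEq] at h
    obtain ⟨rfl, h2⟩ := h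
    rw [Fin.castLE_inj] at h2
    subst h2
    rfl⟩

omit a b x x' in
/-- FILE 2's universal legs embed into the common carrier `Option (Fin n) × Fin 4`. [cite: Balaban1983Higgs3, (1.20) p.416] -/
def embUniv (n : ℕ) : Fin n × Fin 4 ↪ Option (Fin n) × Fin 4 :=
  (Function.Embedding.some).prodMap (Function.Embedding.refl (Fin 4))

omit a b x x' in
/-- kernel: the vertex clusters. [cite: Balaban1983Higgs3, (1.20) p.416] -/
theorem map_some_univ (n : ℕ) :
    (univ : Finset (Fin n)).map Function.Embedding.some = (univ : Finset (Option (Fin n))).erase none := by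
  ext j; cases j <;> simp

variable (ηd lam dm2 : ℝ)

/-- **TRANSPORT**: the amputated connected matrix of the colouring `z` on BRICK 5's carrier `Leg cdeg z` (all legs active,
vertex clusters `univ ∖ {none}`) IS FILE 2's per-colouring matrix `𝒜_{z∘some}(Fin n)` of the vertex data `higgsVD` on the
universal carrier `Fin n × Fin 4` (active legs `(i, r)`, `r < cdeg (z (some i))`). [cite: Balaban1983Higgs3, (1.20)-(1.21) p.416] -/
theorem ampMat_leg_eq_ampMatZ (z : Option (Fin n) → Colour P k N) :
    ampMat Sigma.fst univ (pw (C0 P k N C msq mu0sq) (posL a b x x' z)) (posL a b x x' z)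
        ((univ : Finset (Option (Fin n))).erase none)
      = (higgsVD ηd lam dm2 a b x x').ampMatZ (C0 P k N C msq mu0sq) (fun i => z (some i)) (univ : Finset (Fin n)) := by
  have hC := C0_isSymm (P := P) (k := k) C msq mu0sq
  -- (1) from `Leg cdeg z` to the common carrier
  have hpos₁ : ∀ l : Leg cdeg z, posO a b x x' z (embLeg z l) = posL a b x x' z l := fun l => rfl
  have h1 := ampMat_map (own := (Sigma.fst : Leg cdeg z → Option (Fin n))) (own' := (Prod.fst : Option (Fin n) × Fin 4 → Option (Fin n)))
    (A := (univ : Finset (Leg cdeg z))) (w := pw (C0 P k N C msq mu0sq) (posL a b x x' z))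
    (embLeg z) (Function.Embedding.refl (Option (Fin n))) (fun l => rfl)
    (w' := pw (C0 P k N C msq mu0sq) (posO a b x x' z)) (fun B => pw_map hC (embLeg z) hpos₁ B) hpos₁
    ((univ : Finset (Option (Fin n))).erase none)
  rw [Finset.map_refl] at h1
  -- (2) from the universal carrier to the common carrier
  have hpos₂ : ∀ l : Fin n × Fin 4, posO a b x x' z (embUniv n l)
      = (higgsVD ηd lam dm2 a b x x').lposOf (fun i => z (some i)) l := fun l => rfl
  have h2 := ampMat_map (own := (Prod.fst : Fin n × Fin 4 → Fin n)) (own' := (Prod.fst : Option (Fin n) × Fin 4 → Option (Fin n)))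
    (A := (higgsVD ηd lam dm2 a b x x').act (fun i => z (some i)))
    (w := pw (C0 P k N C msq mu0sq) ((higgsVD ηd lam dm2 a b x x').lposOf (fun i => z (some i))))
    (embUniv n) Function.Embedding.some (fun l => rfl)
    (w' := pw (C0 P k N C msq mu0sq) (posO a b x x' z)) (fun B => pw_map hC (embUniv n) hpos₂ B) hpos₂
    (univ : Finset (Fin n))
  rw [map_some_univ] at h2
  rw [← h1, VertexData.ampMatZ, ← h2]
  -- (3) the two images have the same legs over the vertex clusters
  refine ampMat_congr (fun l hl => ?_) (fun B _ => rfl) (fun l _ => rfl)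
  obtain ⟨j, r⟩ := l
  obtain ⟨hj, -⟩ := mem_erase.1 hl
  obtain ⟨i, rfl⟩ := Option.ne_none_iff_exists'.1 hj
  simp only [mem_map, mem_univ, true_and, embLeg, embUniv, Function.Embedding.coeFn_mk, Function.Embedding.prodMap,
    Function.Embedding.some_apply, Function.Embedding.refl_apply, Prod.map, Prod.mk.injEq, VertexData.act, mem_filter]
  constructor
  · rintro ⟨⟨j', s⟩, rfl, hs⟩
    refine ⟨(i, r), ?_, rfl, rfl⟩
    have : (s : ℕ) = r := by rw [← hs]; rfl
    rw [← this]; exact s.2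
  · rintro ⟨⟨i', r'⟩, hr, hi, rfl⟩
    rw [Option.some_inj] at hi
    subst hi
    exact ⟨⟨some i', ⟨r', hr⟩⟩, rfl, Fin.ext rfl⟩

end Colouring

/-! ## §6 THE HEADLINE: `(d/dt)ⁿG^ε_t|₀ = C₀·𝔸ₙ·C₀` — BRICK 5's vertex coefficients of (1.19) are the coefficients of the
two-point series `G(t)` of the labelled machine, hence (FILE 3) the Dyson equation `Eq121` / p32's `greenSeries` / the printed
series FROM (1.19) -/

section Headline

open B3Eq119ConnectedGraphs B3GaussianPerturbationGraphs HiggsLattice B1Sect1Statements B3Eq119VertexExpansion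
open scoped Nat

variable {D : ModelData} {P : HiggsLattice.Params}

/-- The vertex data of (1.20) for the model `D` at level `0` (observable `φ_a(x)φ_b(x′)`). [cite: Balaban1983Higgs3, (1.20) p.416] -/
noncomputable abbrev vdata (D : ModelData) (P : HiggsLattice.Params) (a b : Fin D.N) (x x' : HiggsLattice.Site P 0) :
    VertexData (Colour P 0 D.N) (HiggsLattice.Site P 0 × Fin D.N) ℝ 4 :=
  higgsVD (P.mesh 0 ^ P.d) D.lam (D.δmsq P.ε D.C.e D.lam) a b x x'

/-- The free propagator matrix of the model `D` at level `0`. [cite: Balaban1983Higgs3, (1.21) p.416] -/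
noncomputable abbrev cmat (D : ModelData) (P : HiggsLattice.Params) :
    Matrix (HiggsLattice.Site P 0 × Fin D.N) (HiggsLattice.Site P 0 × Fin D.N) ℝ :=
  C0 P 0 D.N D.C D.msq D.mu0sq

/-- kernel: BRICK 5's colourings of the `n + 1` clusters are FILE 2's colourings of the `n` vertices (the observable cluster
carries the observable colour), with `Π_j ccoef = coefOf`. [cite: Balaban1983Higgs3, (1.20) p.416] -/
theorem sum_piFinset_cK_eq {n : ℕ} (a b : Fin D.N) (x x' : HiggsLattice.Site P 0)
    (F : (Option (Fin n) → Colour P 0 D.N) → ℝ) (G : (Fin n → Colour P 0 D.N) → ℝ)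
    (hFG : ∀ z, z none = Sum.inl () → F z = G fun i => z (some i)) :
    ∑ z ∈ Fintype.piFinset (cK (P := P) (k := 0) (N := D.N) (n := n)),
        (∏ j, ccoef (P.mesh 0 ^ P.d) D.lam (D.δmsq P.ε D.C.e D.lam) j (z j)) * F z
      = ∑ z' ∈ (vdata D P a b x x').col univ, (vdata D P a b x x').coefOf univ z' * G z' := by
  have hz0 : ∀ z ∈ Fintype.piFinset (cK (P := P) (k := 0) (N := D.N) (n := n)), z none = Sum.inl () := fun z hz => by
    simpa [cK] using Fintype.mem_piFinset.1 hz none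
  refine sum_nbij' (fun z => fun i => z (some i)) (fun z' => fun j => j.elim (Sum.inl ()) z') (fun z hz => ?_)
    (fun z' hz' => ?_) (fun z hz => ?_) (fun z' _ => rfl) (fun z hz => ?_)
  · rw [VertexData.mem_col]
    refine ⟨fun v _ => ?_, fun v hv => absurd (mem_univ v) hv⟩
    simpa [cK, vdata, higgsVD] using Fintype.mem_piFinset.1 hz (some v)
  · rw [VertexData.mem_col] at hz'
    refine Fintype.mem_piFinset.2 fun j => ?_
    cases j with
    | none => simp [cK]
    | some v => simpa [cK, vdata, higgsVD] using hz'.1 v (mem_univ v)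
  · funext j
    cases j with
    | none => exact (hz0 z hz).symm
    | some v => rfl
  · rw [hFG z (hz0 z hz), Fintype.prod_option, VertexData.coefOf,
      Finset.prod_congr rfl fun i _ => ccoef_some (P.mesh 0 ^ P.d) D.lam (D.δmsq P.ε D.C.e D.lam) i (z (some i)),
      show ccoef (P := P) (k := 0) (P.mesh 0 ^ P.d) D.lam (D.δmsq P.ε D.C.e D.lam) (none : Option (Fin n)) (z none) = 1
        from rfl, one_mul]
    rfl

/-- **`(d/dt)ⁿ G^ε_t|_{t=0} (x,a; x′,b) = δ_{n0} C₀ + (C₀ · 𝔸ₙ · C₀)((x,a),(x′,b))`** at `e = 0` (`m², μ₀², λ > 0`): BRICK 5's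
`n`-th vertex coefficient of the two-point function (1.19) — the sum over the CONNECTED Feynman graphs with `n` vertices
(1.6)/(1.7) — is the `n`-vertex colour-summed labelled amputated connected two-point matrix `𝔸ₙ = ANat` of FILE 3 for the
vertex data (1.20), dressed with the two external free propagators. [cite: Balaban1983Higgs3, (1.19)-(1.21) p.416] -/
theorem iteratedDerivWithin_twoPointFamily_eq_ANat (he : D.C.e = 0) (hm : 0 < D.msq) (hmu : 0 < D.mu0sq) (hlam : 0 < D.lam)
    (a b : Fin D.N) (x x' : HiggsLattice.Site P 0) (n : ℕ) :
    iteratedDerivWithin n (twoPointFamily D P a b x x') (Set.Ici 0) 0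
      = (if n = 0 then cmat D P (x, a) (x', b) else 0)
        + (cmat D P * (vdata D P a b x x').ANat (cmat D P) n * cmat D P) (x, a) (x', b) := by
  rcases Nat.eq_zero_or_pos n with rfl | hn
  · rw [iteratedDerivWithin_zero, twoPointFamily_zero, if_pos rfl, VertexData.ANat_zero, Matrix.mul_zero, Matrix.zero_mul,
      Matrix.zero_apply, add_zero]
    rfl
  rw [if_neg hn.ne', zero_add, iteratedDerivWithin_twoPointFamily_eq_sum_connected he hm hmu hlam,
    sum_piFinset_cK_eq a b x x' _ (fun z' => (cmat D P * (vdata D P a b x x').ampMatZ (cmat D P) z' univ * cmat D P) (x, a) (x', b))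
      (fun z hz => by
        rw [sum_conn_eq_mul_ampMat_mul a b x x' D.C D.msq D.mu0sq he hm hmu hn.ne' hz,
          ampMat_leg_eq_ampMatZ a b x x' D.C D.msq D.mu0sq (P.mesh 0 ^ P.d) D.lam (D.δmsq P.ε D.C.e D.lam)]),
    VertexData.ANat, VertexData.AMat, Finset.mul_sum, Finset.sum_mul, Matrix.sum_apply]
  refine sum_congr rfl fun z' _ => ?_
  rw [Matrix.mul_smul, Matrix.smul_mul, Matrix.smul_apply, smul_eq_mul]

/-- **THE SAME, AS THE COEFFICIENTS OF THE TWO-POINT SERIES `G(t)`**: `(d/dt)ⁿ G^ε_t|_{t=0} = n! · coeffₙ G(t)` entrywise, with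
`G(t) = gSer` the two-point series of FILE 3 for the vertex data (1.20) and the free propagator `C₀` — so the vertex expansion
(1.19) of the two-point function, as a formal power series in `t`, IS `G(t)`. [cite: Balaban1983Higgs3, (1.19)-(1.21) p.416] -/
theorem iteratedDerivWithin_twoPointFamily_eq_coeff_gSer (he : D.C.e = 0) (hm : 0 < D.msq) (hmu : 0 < D.mu0sq)
    (hlam : 0 < D.lam) (a b : Fin D.N) (x x' : HiggsLattice.Site P 0) (n : ℕ) :
    iteratedDerivWithin n (twoPointFamily D P a b x x') (Set.Ici 0) 0
      = ((n ! : ℚ) • PowerSeries.coeff n ((vdata D P a b x x').gSer (cmat D P))) (x, a) (x', b) := by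
  have h3 : (n ! : ℚ) ≠ 0 := by exact_mod_cast (Nat.factorial_pos n).ne'
  rw [iteratedDerivWithin_twoPointFamily_eq_ANat he hm hmu hlam, VertexData.coeff_gSer, smul_add, smul_smul,
    mul_inv_cancel₀ h3, one_smul, Matrix.add_apply]
  congr 1
  split_ifs with h0
  · subst h0; rw [Nat.factorial_zero, Nat.cast_one, one_smul]
  · rw [smul_zero]; rfl

open PowerSeries.WithPiTopology in
/-- **(1.21) FROM (1.19) — THE DYSON RESUMMATION OF THE LABELLED EXPANSION, at `e = 0`.** For the `(Higgs)₂,₃` two-point function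
(1.19) with `m², μ₀², λ > 0`: its vertex coefficients `(d/dt)ⁿG^ε_t|₀` (BRICK 5: sums over connected Feynman graphs) are
`n! · coeffₙ G(t)` of the two-point series `G(t) = C₀ + C₀·𝔸(t)·C₀` of the labelled machine, AND `G(t)` satisfies r15's resummed
(1.21) `Eq121 G C₀ X` with the insertion `X = 𝕂(t)` = the generating series of the labelled coloured amputated
ONE-PARTICLE-IRREDUCIBLE two-point graphs (`= sigmaSeries gAmp gDeg`, p32), equals p32's chain series `greenSeries C₀ gAmp gDeg`,
and equals the printed series `Σ'ₙ C₀[X C₀]ⁿ`. (Labelled graphs, one order-counting variable `t` = number of vertices; the split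
of `X` into print's five letters and `ε → 0` are not addressed.) [cite: Balaban1983Higgs3, (1.19)-(1.21) p.416] -/
theorem dyson_from_eq119 (he : D.C.e = 0) (hm : 0 < D.msq) (hmu : 0 < D.mu0sq) (hlam : 0 < D.lam) (a b : Fin D.N)
    (x x' : HiggsLattice.Site P 0) :
    (∀ n : ℕ, iteratedDerivWithin n (twoPointFamily D P a b x x') (Set.Ici 0) 0
        = ((n ! : ℚ) • PowerSeries.coeff n ((vdata D P a b x x').gSer (cmat D P))) (x, a) (x', b))
      ∧ B3Sect1TwoPoint.Eq121 ((vdata D P a b x x').gSer (cmat D P)) (PowerSeries.C (cmat D P)) ((vdata D P a b x x').kSer (cmat D P))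
      ∧ (vdata D P a b x x').kSer (cmat D P) = B3Eq121OnePIChains.sigmaSeries ((vdata D P a b x x').gAmp (cmat D P)) (vdata D P a b x x').gDeg
      ∧ (vdata D P a b x x').gSer (cmat D P)
          = B3Eq121OnePIChains.greenSeries (cmat D P) ((vdata D P a b x x').gAmp (cmat D P)) (vdata D P a b x x').gDeg
      ∧ (vdata D P a b x x').gSer (cmat D P)
          = ∑' m, B3Sect1TwoPoint.dysonTerm (PowerSeries.C (cmat D P)) ((vdata D P a b x x').kSer (cmat D P)) m :=
  ⟨iteratedDerivWithin_twoPointFamily_eq_coeff_gSer he hm hmu hlam a b x x',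
    VertexData.eq121_gSer (C0_isSymm D.C D.msq D.mu0sq), VertexData.kSer_eq_sigmaSeries,
    VertexData.gSer_eq_greenSeries (C0_isSymm D.C D.msq D.mu0sq), VertexData.gSer_eq_tsum_dysonTerm (C0_isSymm D.C D.msq D.mu0sq)⟩

end Headline

end Literature.MathematicalPhysics.QuantumFieldTheory.Balaban1983to89.B3Eq121DysonFromEq119
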